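import Mathlib
import HarnessLib
import Literature.Probability.MarkovChains.GlauberDynamics
import Literature.Probability.MarkovChains.StochasticDomination

/-!
# Single-site updates of a law with increasing likelihood ratio (Levin–Peres–Wilmer §22.6, Lemmas 22.21, 22.23, 22.24)

HONEST FRAMING: exact (Metropolis-corrected) sampling algorithms for lattice gauge theory; figures
of merit are autocorrelation/cost numbers at stated couplings and volumes; no continuum-physics claim.

Conventions of `GlauberDynamics.lean` (`AgreeOff σ v y`: `y ∈ σ•_v`, the configurations agreeing
with `σ` off the site `v`; `siteMass π σ v = π(σ•_v)`; `glauberSiteLaw π σ v` = the heat-bath / Glauber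
update law at `v`, the book's `P_v(σ, ·)`), `TotalVariation.lean` (`stepLaw P μ = μP`),
`DistinguishingStatistic.lean` (`lawMean`), `StochasticDomination.lean` (`StochDom μ ν` = `μ ⪯ ν`,
`IsMonotoneChain`); configurations differing at one site of a chain-valued system are comparable
(`IsingGlauberMonotone.lean`'s `AgreeOff.le_or_ge`, re-proved privately here).  Configurations `σ : V → S` (finite sites `V`, finite totally ordered spin set
`S`) with the coordinate-wise order; `π > 0` on ALL of `S^V` (the scope of `GlauberDynamics.lean`;
the book allows a sub-system `X ⊆ S^V`, see `TODO(general form)` below); for a law `μ`,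
`μ_v := μ P_v` is the law after one update at `v`.  Source: D. A. Levin, Y. Peres (with E. L. Wilmer),
*Markov Chains and Mixing Times*, 2nd ed., AMS 2017 [LevinPeres2017], §22.6 "Censoring Inequality",
eq. (22.9) and Lemmas 22.21, 22.23, 22.24 with their proofs (pp. 315–316; read from the author-hosted
copy).  Everything is PROVED (0 named facts).

* **eq. (22.9)** `LevinPeres2017_eq_22_9` — `μ_v(σ) = (π(σ)/π(σ•_v)) μ(σ•_v)`
  [cite: LevinPeres2017, §22.6 eq. (22.9)]; equivalently `(μ_v/π)(σ) = (P_v(μ/π))(σ)`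
  (`stepLaw_siteLaw_div_eq`) [cite: LevinPeres2017, §22.6, proof of Lemma 22.21 (the displayed chain
  of equalities)];
* **LEMMA 22.21** `LevinPeres2017_lemma_22_21` — if `μ/π` is increasing and `P_v` is monotone, then
  `μ_v/π` is increasing [cite: LevinPeres2017, §22.6 Lemma 22.21];
* **LEMMA 22.23** `LevinPeres2017_lemma_22_23` — on a totally ordered finite set, if `α/β` is
  increasing (`β > 0`, probability vectors) then `α ⪰ β` [cite: LevinPeres2017, §22.6 Lemma 22.23];
* **LEMMA 22.24** `LevinPeres2017_lemma_22_24` — if `μ/π` is increasing then `μ ⪰ μ_v` for every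
  site `v` [cite: LevinPeres2017, §22.6 Lemma 22.24] — the book applies Lemma 22.23 on each fibre
  `X(v,τ)` and sums over `τ`; here the same Chebyshev expansion
  `Σ_σ Σ_{y ∈ σ•_v} π(σ)π(y)/π(σ•_v) · (r(σ) − r(y))(f(σ) − f(y)) ≥ 0` (`r = μ/π`; two configurations
  differing at one site of a chain-valued system are comparable) is summed over all fibres at once.

`TODO(general form)`: the book's monotone spin systems live on a subset `X ⊆ S^V` (hard-core
configurations, `k`-particle systems) and Lemma 22.21 then uses the increasing extension (22.10) of
`μ/π`; here `X = S^V`.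

Context (cell pub-lqcd, venture LatticeQCDFlow): these are the three steps of the censoring inequality
(Theorem 22.20, Peres–Winkler) for heat-bath sweeps of monotone systems — "skipping updates cannot
help" — the tool by which systematic-scan / partial-sweep heat-bath schedules are compared.
-/

namespace Literature.Probability.MarkovChains

open Finset Function

variable {V S : Type*} [Fintype V] [DecidableEq V] [Fintype S] [DecidableEq S] [LinearOrder S]

/-! In the statements below `P_v` is written `(fun x y => glauberSiteLaw π x v y)`, the single-site
(heat-bath) update kernel at `v`, `P_v(σ, y) = π_{σ,v}(y)`. -/

variable {π : (V → S) → ℝ}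

/-! ## The kernel `P_v` and eq. (22.9) -/

omit [Fintype V] [Fintype S] [DecidableEq S] in
/-- Two configurations of totally ordered spins that agree off one site are comparable.
[folklore] -/
private theorem agreeOff_le_or_ge {σ y : V → S} {v : V} (h : AgreeOff σ v y) : σ ≤ y ∨ y ≤ σ := by
  rcases le_total (σ v) (y v) with hv | hv
  · refine Or.inl fun w => ?_
    by_cases hw : w = v
    · subst hw; exact hv
    · exact (h w hw).symm.le
  · refine Or.inr fun w => ?_
    by_cases hw : w = v
    · subst hw; exact hv
    · exact (h w hw).le

omit [LinearOrder S] in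
/-- `P_v` is a transition matrix for `π > 0`. [cite: LevinPeres2017, §3.3.2 eq. (3.7) / §22.3.1
("We write `P_v` for the Markov chain which updates `σ` at `v`")] -/
theorem siteLaw_isRowStochastic (hπ : ∀ x, 0 < π x) (v : V) : IsRowStochastic (fun x y : V → S => glauberSiteLaw π x v y) :=
  ⟨fun x y => glauberSiteLaw_nonneg (fun z => (hπ z).le) x v y,
    fun x => sum_glauberSiteLaw (siteMass_pos hπ x v).ne'⟩

omit [LinearOrder S] in
/-- `π` is stationary for each `P_v` (indeed reversible, `GlauberDynamics.mul_glauberSiteLaw_comm`).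
[cite: LevinPeres2017, §22.6 ("When iterated, the distribution converges to `μ`" — `π P_v = π`)] -/
theorem siteLaw_isStationary (hπ : ∀ x, 0 < π x) (v : V) : IsStationary π (fun x y : V → S => glauberSiteLaw π x v y) :=
  DetailedBalance.isStationary (fun x y => mul_glauberSiteLaw_comm π x y v)
    (siteLaw_isRowStochastic hπ v).2

omit [LinearOrder S] in
/-- **Eq. (22.9)**: `μ_v(σ) = (π(σ)/π(σ•_v)) · μ(σ•_v)`. [cite: LevinPeres2017, §22.6 eq. (22.9)] -/
theorem LevinPeres2017_eq_22_9 (μ : (V → S) → ℝ) (v : V) (σ : V → S) :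
    stepLaw (fun x y : V → S => glauberSiteLaw π x v y) μ σ = π σ / siteMass π σ v * siteMass μ σ v := by
  simp only [stepLaw, glauberSiteLaw]
  rw [siteMass, siteMass, mul_sum]
  rw [← sum_filter_add_sum_filter_not univ (AgreeOff σ v) (fun x => μ x * _)]
  have h0 : ∑ x ∈ univ.filter (fun x => ¬AgreeOff σ v x),
      μ x * (if AgreeOff x v σ then π σ / siteMass π x v else 0) = 0 :=
    sum_eq_zero fun x hx => by
      rw [if_neg (fun h => (mem_filter.mp hx).2 h.symm), mul_zero]
  rw [h0, add_zero]
  refine sum_congr rfl fun x hx => ?_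
  have hx' : AgreeOff σ v x := (mem_filter.mp hx).2
  rw [if_pos hx'.symm, siteMass_eq_of_agreeOff hx', siteMass]
  ring

omit [LinearOrder S] in
/-- The likelihood ratio after an update: `(μ_v/π)(σ) = Σ_y P_v(σ,y) (μ/π)(y) = (P_v(μ/π))(σ)`.
[cite: LevinPeres2017, §22.6, proof of Lemma 22.21 (the displayed computation
`(μ_v/π)(σ) = μ(σ•_v)/π(σ•_v) = Σ_s f(σ_v^s)π(σ_v^s)/π(σ•_v) = P_v f(σ)`)] -/
theorem stepLaw_siteLaw_div_eq (hπ : ∀ x, 0 < π x) (μ : (V → S) → ℝ) (v : V) (σ : V → S) :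
    stepLaw (fun x y : V → S => glauberSiteLaw π x v y) μ σ / π σ = lawMean (fun y => glauberSiteLaw π σ v y) (fun y => μ y / π y) := by
  have hπσ : π σ ≠ 0 := (hπ σ).ne'
  have hm : siteMass π σ v ≠ 0 := (siteMass_pos hπ σ v).ne'
  rw [LevinPeres2017_eq_22_9, lawMean]
  simp only [glauberSiteLaw, ite_mul, zero_mul]
  rw [← sum_filter, show siteMass μ σ v = ∑ y ∈ univ.filter (AgreeOff σ v), μ y from rfl]
  have hl : π σ / siteMass π σ v * (∑ y ∈ univ.filter (AgreeOff σ v), μ y) / π σ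
      = (∑ y ∈ univ.filter (AgreeOff σ v), μ y) / siteMass π σ v := by
    field_simp
  rw [hl, sum_div]
  refine sum_congr rfl fun y _ => ?_
  have hπy : π y ≠ 0 := (hπ y).ne'
  rw [div_mul_div_comm, mul_comm (π y) (μ y), mul_div_mul_right (μ y) (siteMass π σ v) hπy]

/-! ## Lemma 22.21 -/

/-- **LEMMA 22.21.**  If `μ/π` is increasing and `P_v` is monotone (a monotone spin system), then
`μ_v/π` is increasing. [cite: LevinPeres2017, §22.6 Lemma 22.21] -/
theorem LevinPeres2017_lemma_22_21 (hπ : ∀ x, 0 < π x) {v : V} (hPv : IsMonotoneChain (fun x y : V → S => glauberSiteLaw π x v y))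
    {μ : (V → S) → ℝ} (hμ : Monotone (fun σ => μ σ / π σ)) :
    Monotone (fun σ => stepLaw (fun x y : V → S => glauberSiteLaw π x v y) μ σ / π σ) := by
  have h : (fun σ => stepLaw (fun x y : V → S => glauberSiteLaw π x v y) μ σ / π σ) = fun σ => lawMean (fun y => glauberSiteLaw π σ v y) (fun y => μ y / π y) :=
    funext fun σ => stepLaw_siteLaw_div_eq hπ μ v σ
  rw [h]
  exact hPv _ hμ

/-! ## Lemma 22.23 -/

omit [Fintype V] [DecidableEq V] [Fintype S] [DecidableEq S] [LinearOrder S] in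
/-- On a chain, two increasing functions are similarly ordered: `(r a − r b)(f a − f b) ≥ 0`.
[cite: LevinPeres2017, §22.4, proof of Lemma 22.12 (the events `{f(X) ≤ f(Y)}`, `{g(X) ≤ g(Y)}`
coincide)] -/
private theorem sub_mul_sub_nonneg {T : Type*} [LinearOrder T] {r f : T → ℝ} (hr : Monotone r)
    (hf : Monotone f) (a b : T) : 0 ≤ (r a - r b) * (f a - f b) := by
  rcases le_total a b with h | h
  · exact mul_nonneg_of_nonpos_of_nonpos (sub_nonpos.mpr (hr h)) (sub_nonpos.mpr (hf h))
  · exact mul_nonneg (sub_nonneg.mpr (hr h)) (sub_nonneg.mpr (hf h))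

omit [Fintype V] [DecidableEq V] [Fintype S] [DecidableEq S] [LinearOrder S] in
/-- **LEMMA 22.23.**  If `T` is totally ordered and `α, β` are probability vectors on `T` with `β > 0`
and `α/β` increasing, then `α ⪰ β`: for increasing `g`,
`Σ g α = Σ g (α/β) β ≥ (Σ g β)(Σ (α/β) β) = Σ g β` by Lemma 22.12 (Chebyshev).
[cite: LevinPeres2017, §22.6 Lemma 22.23] -/
theorem LevinPeres2017_lemma_22_23 {T : Type*} [Fintype T] [LinearOrder T] {α β : T → ℝ}
    (hβ : ∀ t, 0 < β t) (hα1 : ∑ t, α t = 1) (hβ1 : ∑ t, β t = 1)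
    (hr : Monotone (fun t => α t / β t)) : StochDom β α := by
  intro g hg
  simp only [lawMean]
  -- Chebyshev's expansion for the weight `β`, the functions `r = α/β` and `g`
  have hkey : 0 ≤ ∑ a, ∑ b, β a * β b * ((α a / β a - α b / β b) * (g a - g b)) :=
    sum_nonneg fun a _ => sum_nonneg fun b _ =>
      mul_nonneg (mul_nonneg (hβ a).le (hβ b).le) (sub_mul_sub_nonneg hr hg a b)
  have hαβ : ∀ t, β t * (α t / β t) = α t := fun t => mul_div_cancel₀ _ (hβ t).ne'
  have hexp : ∑ a, ∑ b, β a * β b * ((α a / β a - α b / β b) * (g a - g b))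
      = 2 * (∑ t, α t * g t) * (∑ t, β t) - 2 * (∑ t, α t) * (∑ t, β t * g t) := by
    have e : ∀ a b, β a * β b * ((α a / β a - α b / β b) * (g a - g b))
        = (β a * (α a / β a)) * g a * β b + β a * ((β b * (α b / β b)) * g b)
          - (β a * (α a / β a)) * (β b * g b) - (β a * g a) * (β b * (α b / β b)) := fun a b => by ring
    simp_rw [e, hαβ, sum_sub_distrib, sum_add_distrib, ← mul_sum, ← sum_mul]
    ring
  rw [hexp, hα1, hβ1] at hkey
  linarith

/-! ## Lemma 22.24 -/

/-- **LEMMA 22.24.**  If `μ/π` is increasing (`π > 0`), then `μ ⪰ μ_v` for every site `v`: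
`E_{μ_v} f ≤ E_μ f` for increasing `f`. [cite: LevinPeres2017, §22.6 Lemma 22.24] -/
theorem LevinPeres2017_lemma_22_24 (hπ : ∀ x, 0 < π x) {μ : (V → S) → ℝ}
    (hμ : Monotone (fun σ => μ σ / π σ)) (v : V) : StochDom (stepLaw (fun x y : V → S => glauberSiteLaw π x v y) μ) μ := by
  intro f hf
  -- the symmetric weight `w(σ,y) = π(σ) P_v(σ,y) = π(σ)π(y)/π(σ•_v)` on pairs differing at `v`
  set r : (V → S) → ℝ := fun σ => μ σ / π σ with hr
  have hμr : ∀ σ, μ σ = π σ * r σ := fun σ => by rw [hr]; field_simp [(hπ σ).ne']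
  -- `0 ≤ Σ_σ Σ_y π(σ) P_v(σ,y) (r σ − r y)(f σ − f y)`
  have hkey : 0 ≤ ∑ σ, ∑ y, π σ * glauberSiteLaw π σ v y * ((r σ - r y) * (f σ - f y)) := by
    refine sum_nonneg fun σ _ => sum_nonneg fun y _ => ?_
    by_cases hσy : AgreeOff σ v y
    · refine mul_nonneg (mul_nonneg (hπ σ).le (glauberSiteLaw_nonneg (fun z => (hπ z).le) σ v y)) ?_
      rcases agreeOff_le_or_ge hσy with h | h
      · exact mul_nonneg_of_nonpos_of_nonpos (sub_nonpos.mpr (hμ h)) (sub_nonpos.mpr (hf h))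
      · exact mul_nonneg (sub_nonneg.mpr (hμ h)) (sub_nonneg.mpr (hf h))
    · rw [glauberSiteLaw, if_neg hσy, mul_zero, zero_mul]
  -- expand: the four terms
  have hrow : ∀ σ, ∑ y, glauberSiteLaw π σ v y = 1 := (siteLaw_isRowStochastic hπ v).2
  have hsymm : ∀ σ y, π σ * glauberSiteLaw π σ v y = π y * glauberSiteLaw π y v σ :=
    fun σ y => mul_glauberSiteLaw_comm π σ y v
  have t1 : ∑ σ, ∑ y, π σ * glauberSiteLaw π σ v y * (r σ * f σ) = ∑ σ, μ σ * f σ := by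
    refine sum_congr rfl fun σ _ => ?_
    have : ∑ y, π σ * glauberSiteLaw π σ v y * (r σ * f σ)
        = π σ * r σ * f σ * ∑ y, glauberSiteLaw π σ v y := by
      rw [mul_sum]; exact sum_congr rfl fun y _ => by ring
    rw [this, hrow σ, mul_one, hμr σ]
  have t2 : ∑ σ, ∑ y, π σ * glauberSiteLaw π σ v y * (r y * f y) = ∑ σ, μ σ * f σ := by
    rw [sum_comm]
    refine sum_congr rfl fun y _ => ?_
    have : ∑ σ, π σ * glauberSiteLaw π σ v y * (r y * f y)
        = π y * r y * f y * ∑ σ, glauberSiteLaw π y v σ := by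
      rw [mul_sum]; exact sum_congr rfl fun σ _ => by rw [hsymm σ y]; ring
    rw [this, hrow y, mul_one, hμr y]
  have t3 : ∑ σ, ∑ y, π σ * glauberSiteLaw π σ v y * (r σ * f y)
      = ∑ y, stepLaw (fun x y : V → S => glauberSiteLaw π x v y) μ y * f y := by
    rw [sum_comm]
    refine sum_congr rfl fun y _ => ?_
    simp only [stepLaw, sum_mul]
    exact sum_congr rfl fun σ _ => by rw [hμr σ]; ring
  have t4 : ∑ σ, ∑ y, π σ * glauberSiteLaw π σ v y * (r y * f σ)
      = ∑ y, stepLaw (fun x y : V → S => glauberSiteLaw π x v y) μ y * f y := by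
    rw [← t3, sum_comm]
    refine sum_congr rfl fun y _ => sum_congr rfl fun σ _ => ?_
    rw [hsymm σ y]
  have hexp : ∑ σ, ∑ y, π σ * glauberSiteLaw π σ v y * ((r σ - r y) * (f σ - f y))
      = ∑ σ, ∑ y, π σ * glauberSiteLaw π σ v y * (r σ * f σ)
        + ∑ σ, ∑ y, π σ * glauberSiteLaw π σ v y * (r y * f y)
        - ∑ σ, ∑ y, π σ * glauberSiteLaw π σ v y * (r σ * f y)
        - ∑ σ, ∑ y, π σ * glauberSiteLaw π σ v y * (r y * f σ) := by
    simp only [← sum_sub_distrib, ← sum_add_distrib]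
    exact sum_congr rfl fun σ _ => sum_congr rfl fun y _ => by ring
  rw [hexp, t1, t2, t3, t4] at hkey
  simp only [lawMean]
  linarith

end Literature.Probability.MarkovChains
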